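import Summits.QuantumFields.BalabanUV.Beta.GAN24.SlavedDivRowsOfWardLetters
import Summits.QuantumFields.BalabanUV.Beta.GAN24.WrecAtEvenHalfRowsOfQLCSym

/-!
# `BalabanUV.Beta.GAN24.SlavedDivRowsAtPin` — binder row G-an2-4 ∕ (CONV-C), W-slot, the (α-0) parity re-cut: **THE SLAVED SLOT-DIVERGENCE ROWS OF THE EVEN MEMBERS AND
# OF THEIR DRIFTS ARE THEOREMS AT THE LITERAL OF RECORD** — MY FILE 4 `SlavedDivRowsOfWardLetters` with its Ward-letter displays (D1's raw table laws `hTL hTL″`, residual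
# parities `hR hR″`, lock `cH`, scalar rows `hcH hq`) DISCHARGED EXACTLY AS road-P2 g46's `WrecAtEvenHalfRowsOfBorderLetters` ⨾ `WrecAtEvenHalfRowsOfQLCSym` DISCHARGE THEIRS
# (§1 from an1's border ∕ mixed letters: the all-levels kernel law `WSlotParityJunctionLetters.exists_kernelLaws_vertexForm_parity_TW_su` (Wilson letters for `SU(N)`, `N ≥ 2`),
# d1-leaf-06's `tableLaw_T2RecAt_zero ∕ _succ` + `lock_succ_of_pin`, p2's `CombPinLockScalar.hcH0∕hcH∕hq_pin_three`, the residual words read off the laws and their parities by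
# `parityOdd_*`; §2 the border letters by d1's `bondWardB` ⨾ d1-leaf-05's `hBord0{,''}_of_bondWard` ⨾ d1-leaf-06's `border_level_succ`, the mixed letter by an3 ⨾
# `mixedWardBinders` ⨾ `WardLocusParityLevels`) (G-an2-4 formalisation swarm, leaf prover `b2b-balaban-gan24-formalise-leaf-03`, gen 69; FILE 5′ of the journal INTENT
# [LEAF03-G69-ONLINE] ∕ A-2 ∕ A-3 ∕ A-4)

NOT IN PRINT; OUR BOOKKEEPING ([folklore] TWO compositions BY NAME — the proof TEXTS of p2's two files with the target exchanged; 0 `def`, 0 cited facts, 0 `def … : Prop`,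
0 sorry).  HONEST FRAMING (cell contract, verbatim): «discharging `BetaPertH` makes Bałaban's UV stability UNCONDITIONAL — a real constructive-QFT result; it is NOT the
continuum limit and NOT the Clay problem.»  HONEST DEPENDENCY (verbatim): «continuum YM on T⁴ ⇐ BetaPertH ∧ nine spine estimates (0/9 proved); BetaPertH ⇐ (D1) ∧ (D4) ∧
CAP+tail; G-an2-4 gates asym, D1 and NE2/3/4.»

WHAT (`Lc` odd, `2 ≤ Lc`, colour `SU(N)` with `2 ≤ N`, root `r = ctrOff 4 Lc`, the literal's pins, `ε := 1`):
* §1 **`exists_slavedDivRows_three_of_borderLetters`** — FILE 4's conclusion (`∃ δ₃ σ₁ σ₂ σ₁d σ₂d ν₃, …` the four slaved slot-divergence row families of the even members) from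
  an1's BORDER letters `hBord0 hBord0″ hBordS hBordS″` and MIXED letter `hM₂` with remainders `RB RB″ RM` (classes `hcls0 hclsS`, row parities `hRBp hRB″p hRMp`) — BYTE FOR BYTE
  the letter binders of `exists_allScalesSeq_JsRowD1Pin_of_borderLetters`.
* §2 **`exists_slavedDivRows_three_at_pin`** — the same from NOTHING but `Odd Lc`, `2 ≤ Lc`, `2 ≤ N` and the eight pins (`RB = RB″ = 0`, `RM = wM1 • RWof`), the discharge
  text of `exists_allScalesSeq_JsRowD1Pin_of_QL_CSym`.
CONSEQUENCE (next file): MY FILE 3's `Hh₁ Hh₂ Hh₁d Hh₂d` are GONE — ROAD FP's D1 literal ⟸ the OWNER's three natural-window theorems ∧ (C)sym.  Asserts NO value of any charge;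
NOTHING of (C)sym ∕ (β) discharged; NEVER «G-an2-4 closed» as (CONV-C); NOT D1, NOT `BetaPertH`, NOT continuum, NOT Clay; not in print.
Unit `b2b-balaban-gan24-formalise-leaf-03` (gen 69), 2026-08-23.
-/

noncomputable section

open Finset
open scoped BigOperators
open Literature.MathematicalPhysics.QuantumFieldTheory
open Literature.MathematicalPhysics.QuantumFieldTheory.Balaban1983to89
open Literature.MathematicalPhysics.QuantumFieldTheory.Balaban1983to89.Beta
open ExpKernelCalculus (MKer shiftK BiLoc Decays comp VertexFamily)
open OneStepResolventKernel (Fib LocStencil)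
open OneStepKernelFamily (KInvStep vertexOfK)
open AveragingContoursRooted (ctrOff ctrOff_mem_box)
open WilsonVertex2Sym (wsym22)
open AffineAveraging (box toSite)
open AveragingMixedJetTables (mixFFAt)
open SecondOrderResponse (W2SymOfK LocStencilFM)
open KernelWard (divV)
open BalabanCompositeJets (LocStencil₂)
open BalabanStepJetsSucc (mmRead wE wVH)
open BalabanStepW2 (K3OfK M2Of wV4 wB2 wM1)
open AveragingHessianKernelsRooted (vhSAt)
open Summit.QuantumFields.BalabanUV.Beta.TameKernelCalculus (trK Loc Spr)
open Summit.QuantumFields.BalabanUV.Beta.BorderedHessian (sgnK diagK stepScale)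
open Summit.QuantumFields.BalabanUV.Beta.AveragingWardRootedStencils (legInd)
open Summit.QuantumFields.BalabanUV.Beta.HessKerDressedUnits (unitK unitS)
open Summit.QuantumFields.BalabanUV.Beta.SecondOrderUnits (unitM unitS₂ unitM₂)
open Summit.QuantumFields.BalabanUV.Beta.AxialDressingRooted (coDressKBmAt decays_coDressKBmAt_KInvStep)
open Summit.QuantumFields.BalabanUV.Beta.SpineRooted (T2RecOf T2RecAt SpureRecAt M1At e3OfK)
open Summit.QuantumFields.BalabanUV.Beta.SecondOrderSocketIdentification (vh₂SAn1 vh₂SAn1_inl_inl vh₂SAn1_inr_inr)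
open Summit.QuantumFields.BalabanUV.Beta.SecondOrderTableLawEnd (locStencil₂_vh₂SAn1)
open Summit.QuantumFields.BalabanUV.Beta.MixedJetTablesPlug (hmix_an1)
open Summit.QuantumFields.BalabanUV.Beta.WardLocusQuarticTable (tableLaw_T2RecAt_succ tableLaw_T2RecAt_succ'' tableLaw_T2RecAt_zero tableLaw_T2RecAt_zero'' lock_succ_of_pin)
open Summit.QuantumFields.BalabanUV.Beta.WilsonWardColourFree (hWil_wilson_TW_su hWil''_wilson_TW_su)
open Summit.QuantumFields.BalabanUV.Beta.BubbleParity (spr_of_decays trK_coDressKBmAt_KInvStep)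
open Summit.QuantumFields.BalabanUV.Beta.KernelWardRemainderParity (parityOdd_add trK_vertexOfK_eq_neg_sgnK_of_rows)
open Summit.QuantumFields.BalabanUV.Beta.SpineRecursiveParity (parityOdd_smul parityOdd_sum parityOdd_mmRead parityOdd_sandwich parityOdd_zero)
open Summit.QuantumFields.BalabanUV.Beta.BorderWardSiteLaw (bondWardB)
open Summit.QuantumFields.BalabanUV.Beta.WardLettersUnpacking (hBord0_of_bondWard hBord0''_of_bondWard)
open Summit.QuantumFields.BalabanUV.Beta.MixedWardPacking (RWof)
open Summit.QuantumFields.BalabanUV.Beta.MixedWardSiteLaw (mixedWardBinders)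
open Summit.QuantumFields.BalabanUV.Beta.WardLocusParityLevels (smul_sum_divV_smul M1At_eq_smul_zero_level M2Of_apply comm_smul residual_law_smul vertexFamily_smul cH_mul_wM2)
open Summit.QuantumFields.BalabanUV.Beta.SymWardLettersAn1 (border_level_succ)
open Summit.QuantumFields.BalabanUV.Beta.GAN24.CombesThomas (sfStep smStep)
open Summit.QuantumFields.BalabanUV.Beta.GAN24.WardResidualParity (parityOdd_zero_family)
open Summit.QuantumFields.BalabanUV.Beta.GAN24.WSlotParityJunctionLetters (exists_kernelLaws_vertexForm_parity_TW_su)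
open Summit.QuantumFields.BalabanUV.Beta.GAN24.CombPinLockScalar (hcH0_pin_three hcH_pin_three hq_pin_three)
open Summit.QuantumFields.BalabanUV.Beta.GAN24.SlavedDivRowsOfWardLetters (exists_slavedDivRows_halfMember_three_of_wardLetters)

namespace Summit.QuantumFields.BalabanUV.Beta.GAN24.SlavedDivRowsAtPin

variable {Lc : ℕ} [NeZero Lc]

/-! ## §1 From an1's border and mixed letters (p2's `…OfBorderLetters` discharge text, target exchanged) -/

/-- NOT IN PRINT; OUR BOOKKEEPING.  **THE SLAVED SLOT-DIVERGENCE ROWS OF THE EVEN MEMBERS + DRIFTS FROM an1's BORDER AND MIXED LETTERS** (the letter binders of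
`WrecAtEvenHalfRowsOfBorderLetters.exists_allScalesSeq_JsRowD1Pin_of_borderLetters` byte for byte; the table laws, residual words and their parities, the pinned lock and the two
scalar rows are built from them as there, then MY FILE 4). -/
theorem exists_slavedDivRows_three_of_borderLetters (hLc : Odd Lc) (hL2 : 2 ≤ Lc) {N : ℕ} (hN : 2 ≤ N) {r : Fin (3 + 1) → ℕ} (hr : r = ctrOff (3 + 1) Lc)
    {cE cVH cΛ cE₂ cB : ℝ} (hcE : cE = (Lc : ℝ) ^ (3 + 1)) (hcVH : cVH = -((Lc : ℝ) ^ (3 + 1) * (1 / 2) * (Lc : ℝ) ^ (3 + 1))) (hcE₂ : cE₂ = (Lc : ℝ) ^ (2 * (3 + 1)))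
    {Tc : Fin 4 → Fin 4 → Fin 4 → Fin 4 → ℝ} (hTc : Tc = (8 * (N : ℝ) ^ 2)⁻¹ • wsym22 N)
    {vh₂S : (Fin (3 + 1) → (Fin (3 + 1) → ℤ) → Fin (3 + 1) → (Fin (3 + 1) → ℤ) → MKer (3 + 1) (Fib 3))} (hvh : vh₂S = vh₂SAn1 Lc)
    {RB RB'' : ℕ → (Fin (3 + 1) → ℤ) → Fin (3 + 1) → (Fin (3 + 1) → ℤ) → MKer (3 + 1) (Fib 3)} {RM : ℕ → (Fin (3 + 1) → ℤ) → Fin (3 + 1) → (Fin (3 + 1) → ℤ) → MKer (3 + 1) (Fib 3)}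
    (hcls0 : ∃ C δ : ℝ, 0 < δ ∧ (∀ Y, LocStencil (RB 0 Y) C δ) ∧ (∀ Y, LocStencil (RB'' 0 Y) C δ) ∧ (∀ y, VertexFamily (RM 0 y) Lc C δ))
    (hclsS : ∀ j : ℕ, ∃ C δ : ℝ, 0 < δ ∧ (∀ Y, LocStencil (RB (j + 1) Y) C δ) ∧ (∀ Y, LocStencil (RB'' (j + 1) Y) C δ) ∧
      (∀ y, VertexFamily (RM (j + 1) y) Lc C δ))
    -- the three remaining letter-remainder ROW PARITIES (the Wilson letters are EXACT at `T_W`: `RW = RW″ = 0`)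
    (hRBp : ∀ j Y κ u, trK (RB j Y κ u) = -sgnK (RB j Y κ u)) (hRB''p : ∀ j Y κ u, trK (RB'' j Y κ u) = -sgnK (RB'' j Y κ u))
    (hRMp : ∀ j y ρ w, trK (RM j y ρ w) = -sgnK (RM j y ρ w))
    (hBord0 : ∀ (Y : Fin (3 + 1) → ℤ) (κ' : Fin (3 + 1)) (u' : Fin (3 + 1) → ℤ),
      (stepScale 3 Lc 0 * (Lc : ℝ) ^ (3 + 1))⁻¹ • ∑ v ∈ box (3 + 1) Lc, divV (fun κ u => cB • vh₂S κ u κ' u') ((Lc : ℤ) • Y + toSite v) =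
        comp (cVH • vhSAt (toSite r) 3 Lc rfl κ' u') (diagK (((1 : ℝ) / 2) • ∑ v ∈ box (3 + 1) Lc, legInd (toSite r) ((Lc : ℤ) • Y + toSite v)))
          - comp (diagK (((1 : ℝ) / 2) • ∑ v ∈ box (3 + 1) Lc, legInd (toSite r) ((Lc : ℤ) • Y + toSite v))) (cVH • vhSAt (toSite r) 3 Lc rfl κ' u')
          + RB 0 Y κ' u')
    (hBord0'' : ∀ (Y : Fin (3 + 1) → ℤ) (κ : Fin (3 + 1)) (u : Fin (3 + 1) → ℤ),
      (stepScale 3 Lc 0 * (Lc : ℝ) ^ (3 + 1))⁻¹ • ∑ v ∈ box (3 + 1) Lc, divV (fun κ' u' => cB • vh₂S κ u κ' u') ((Lc : ℤ) • Y + toSite v) =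
        comp (cVH • vhSAt (toSite r) 3 Lc rfl κ u) (diagK (((1 : ℝ) / 2) • ∑ v ∈ box (3 + 1) Lc, legInd (toSite r) ((Lc : ℤ) • Y + toSite v)))
          - comp (diagK (((1 : ℝ) / 2) • ∑ v ∈ box (3 + 1) Lc, legInd (toSite r) ((Lc : ℤ) • Y + toSite v))) (cVH • vhSAt (toSite r) 3 Lc rfl κ u)
          + RB'' 0 Y κ u)
    (hBordS : ∀ (j : ℕ) (Y : Fin (3 + 1) → ℤ) (κ' : Fin (3 + 1)) (u' : Fin (3 + 1) → ℤ),
      (stepScale 3 Lc (j + 1) * (Lc : ℝ) ^ (3 + 1))⁻¹ •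
          ∑ v ∈ box (3 + 1) Lc, divV (fun κ u => (cB * wB2 3 Lc (j + 1)) • vh₂S κ u κ' u') ((Lc : ℤ) • Y + toSite v) =
        comp ((cVH * wVH 3 Lc (j + 1)) • vhSAt (toSite r) 3 Lc rfl κ' u') (diagK (((1 : ℝ) / 2) • ∑ v ∈ box (3 + 1) Lc, legInd (toSite r) ((Lc : ℤ) • Y + toSite v)))
          - comp (diagK (((1 : ℝ) / 2) • ∑ v ∈ box (3 + 1) Lc, legInd (toSite r) ((Lc : ℤ) • Y + toSite v))) ((cVH * wVH 3 Lc (j + 1)) • vhSAt (toSite r) 3 Lc rfl κ' u')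
          + RB (j + 1) Y κ' u')
    (hBordS'' : ∀ (j : ℕ) (Y : Fin (3 + 1) → ℤ) (κ : Fin (3 + 1)) (u : Fin (3 + 1) → ℤ),
      (stepScale 3 Lc (j + 1) * (Lc : ℝ) ^ (3 + 1))⁻¹ •
          ∑ v ∈ box (3 + 1) Lc, divV (fun κ' u' => (cB * wB2 3 Lc (j + 1)) • vh₂S κ u κ' u') ((Lc : ℤ) • Y + toSite v) =
        comp ((cVH * wVH 3 Lc (j + 1)) • vhSAt (toSite r) 3 Lc rfl κ u) (diagK (((1 : ℝ) / 2) • ∑ v ∈ box (3 + 1) Lc, legInd (toSite r) ((Lc : ℤ) • Y + toSite v)))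
          - comp (diagK (((1 : ℝ) / 2) • ∑ v ∈ box (3 + 1) Lc, legInd (toSite r) ((Lc : ℤ) • Y + toSite v))) ((cVH * wVH 3 Lc (j + 1)) • vhSAt (toSite r) 3 Lc rfl κ u)
          + RB'' (j + 1) Y κ u)
    (hM₂ : ∀ (j : ℕ) (y : Fin (3 + 1) → ℤ) (ρ' : Fin (3 + 1)) (w : Fin (3 + 1) → ℤ),
      (stepScale 3 Lc j * (Lc : ℝ) ^ (3 + 1))⁻¹ • ∑ v ∈ box (3 + 1) Lc, divV (fun κ u => M2Of 3 Lc (mixFFAt (toSite r) Lc) j κ u ρ' w) ((Lc : ℤ) • y + toSite v) =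
        comp (M1At 3 Lc (toSite r) cΛ j ρ' w) (diagK (((1 : ℝ) / 2) • ∑ v ∈ box (3 + 1) Lc, legInd (toSite r) ((Lc : ℤ) • y + toSite v)))
          - comp (diagK (((1 : ℝ) / 2) • ∑ v ∈ box (3 + 1) Lc, legInd (toSite r) ((Lc : ℤ) • y + toSite v))) (M1At 3 Lc (toSite r) cΛ j ρ' w)
          + RM j y ρ' w) :
    ∃ δ₃ σ₁ σ₂ σ₁d σ₂d ν₃ : ℝ, 0 < δ₃ ∧ 0 ≤ ν₃ ∧ ν₃ < 1 ∧
      (∀ n : ℕ, LocStencil₂ (fun (_ : Fin (3 + 1)) (p : Fin (3 + 1) → ℤ) (κ' : Fin (3 + 1)) (u' : Fin (3 + 1) → ℤ) =>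
      divV (fun κ₁ u₁ => (((1 : ℝ) / 2) • (unitS₂ (sfStep Lc n) (smStep 3 Lc n) (T2RecAt 3 Lc (toSite r) cE cVH cΛ cE₂ cB Tc vh₂S (mixFFAt (toSite r) Lc) n) + (1 : ℝ) • fun κ u κ' u' => sgnK (trK ((unitS₂ (sfStep Lc n) (smStep 3 Lc n) (T2RecAt 3 Lc (toSite r) cE cVH cΛ cE₂ cB Tc vh₂S (mixFFAt (toSite r) Lc) n)) κ u κ' u')))) κ₁ u₁ κ' u') p) σ₁ δ₃) ∧
      (∀ n : ℕ, LocStencil₂ (fun (κ : Fin (3 + 1)) (u : Fin (3 + 1) → ℤ) (_ : Fin (3 + 1)) (p : Fin (3 + 1) → ℤ) =>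
      divV (fun κ₁ u₁ => (((1 : ℝ) / 2) • (unitS₂ (sfStep Lc n) (smStep 3 Lc n) (T2RecAt 3 Lc (toSite r) cE cVH cΛ cE₂ cB Tc vh₂S (mixFFAt (toSite r) Lc) n) + (1 : ℝ) • fun κ u κ' u' => sgnK (trK ((unitS₂ (sfStep Lc n) (smStep 3 Lc n) (T2RecAt 3 Lc (toSite r) cE cVH cΛ cE₂ cB Tc vh₂S (mixFFAt (toSite r) Lc) n)) κ u κ' u')))) κ u κ₁ u₁) p) σ₂ δ₃) ∧
      (∀ n : ℕ, LocStencil₂ (fun (_ : Fin (3 + 1)) (p : Fin (3 + 1) → ℤ) (κ' : Fin (3 + 1)) (u' : Fin (3 + 1) → ℤ) =>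
      divV (fun κ₁ u₁ => ((((1 : ℝ) / 2) • (unitS₂ (sfStep Lc (n + 1)) (smStep 3 Lc (n + 1)) (T2RecAt 3 Lc (toSite r) cE cVH cΛ cE₂ cB Tc vh₂S (mixFFAt (toSite r) Lc) (n + 1)) + (1 : ℝ) • fun κ u κ' u' => sgnK (trK ((unitS₂ (sfStep Lc (n + 1)) (smStep 3 Lc (n + 1)) (T2RecAt 3 Lc (toSite r) cE cVH cΛ cE₂ cB Tc vh₂S (mixFFAt (toSite r) Lc) (n + 1))) κ u κ' u'))))
        - (((1 : ℝ) / 2) • (unitS₂ (sfStep Lc n) (smStep 3 Lc n) (T2RecAt 3 Lc (toSite r) cE cVH cΛ cE₂ cB Tc vh₂S (mixFFAt (toSite r) Lc) n) + (1 : ℝ) • fun κ u κ' u' => sgnK (trK ((unitS₂ (sfStep Lc n) (smStep 3 Lc n) (T2RecAt 3 Lc (toSite r) cE cVH cΛ cE₂ cB Tc vh₂S (mixFFAt (toSite r) Lc) n)) κ u κ' u'))))) κ₁ u₁ κ' u') p) (σ₁d * ν₃ ^ n) δ₃) ∧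
      (∀ n : ℕ, LocStencil₂ (fun (κ : Fin (3 + 1)) (u : Fin (3 + 1) → ℤ) (_ : Fin (3 + 1)) (p : Fin (3 + 1) → ℤ) =>
      divV (fun κ₁ u₁ => ((((1 : ℝ) / 2) • (unitS₂ (sfStep Lc (n + 1)) (smStep 3 Lc (n + 1)) (T2RecAt 3 Lc (toSite r) cE cVH cΛ cE₂ cB Tc vh₂S (mixFFAt (toSite r) Lc) (n + 1)) + (1 : ℝ) • fun κ u κ' u' => sgnK (trK ((unitS₂ (sfStep Lc (n + 1)) (smStep 3 Lc (n + 1)) (T2RecAt 3 Lc (toSite r) cE cVH cΛ cE₂ cB Tc vh₂S (mixFFAt (toSite r) Lc) (n + 1))) κ u κ' u'))))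
        - (((1 : ℝ) / 2) • (unitS₂ (sfStep Lc n) (smStep 3 Lc n) (T2RecAt 3 Lc (toSite r) cE cVH cΛ cE₂ cB Tc vh₂S (mixFFAt (toSite r) Lc) n) + (1 : ℝ) • fun κ u κ' u' => sgnK (trK ((unitS₂ (sfStep Lc n) (smStep 3 Lc n) (T2RecAt 3 Lc (toSite r) cE cVH cΛ cE₂ cB Tc vh₂S (mixFFAt (toSite r) Lc) n)) κ u κ' u'))))) κ u κ₁ u₁) p) (σ₂d * ν₃ ^ n) δ₃) := by
  have hL3 : 3 ≤ Lc := by obtain ⟨k, hk⟩ := hLc; omega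
  have hLc1 : 1 ≤ Lc := by omega
  have hr' : r ∈ box (3 + 1) Lc := hr ▸ ctrOff_mem_box (by omega)
  subst hcE hcVH hTc hvh
  -- the border's class (d1-leaf-06) and the mixed table's class (an1) at the literal's tables
  obtain ⟨CB, δB, hδB, hB⟩ := locStencil₂_vh₂SAn1 hLc
  have hmix : ∃ C δ : ℝ, 0 < δ ∧ LocStencilFM Lc (mixFFAt (toSite r) Lc) C δ := hmix_an1 hLc1 hr'
  -- THE ALL-LEVELS KERNEL LAW OF THE W-LITERAL WITH ITS RESIDUAL TOWER (the chair g38 ⨾ g44 ⨾ leaf-01 g71), Wilson letters discharged (SU(N), N ≥ 2)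
  obtain ⟨Φ, Ψ, -, -, -, -, hclsN, hLAW, hPΨ, hPΦ, -, -, -⟩ :=
    exists_kernelLaws_vertexForm_parity_TW_su hLc1 hr' cΛ cB hcE₂ hN ⟨CB, δB, hδB, hB⟩ hmix hcls0 hclsS hRBp hRB''p hRMp hBord0 hBord0'' hBordS hBordS'' hM₂
  -- the residual `𝒩_m := vertexOfK G_m (Φ m ·) + Ψ m` of the level-`m` kernel law: localised, row-parity-odd
  have h𝒩 : ∀ (m : ℕ) (y : Fin (3 + 1) → ℤ) (ν : Fin (3 + 1)) (y' : Fin (3 + 1) → ℤ),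
      Loc (vertexOfK (coDressKBmAt (toSite r) Lc (KInvStep (d := 3) Lc m)) Lc (Φ m y) ν y' + Ψ m y ν y') := fun m y ν y' => by
    obtain ⟨C, δ, hδ, hV⟩ := hclsN m
    exact ⟨_, _, _, δ, hδ, hV y ν y'⟩
  have h𝒩par : ∀ (m : ℕ) (y : Fin (3 + 1) → ℤ) (ν : Fin (3 + 1)) (y' : Fin (3 + 1) → ℤ),
      trK (vertexOfK (coDressKBmAt (toSite r) Lc (KInvStep (d := 3) Lc m)) Lc (Φ m y) ν y' + Ψ m y ν y') = -sgnK (vertexOfK (coDressKBmAt (toSite r) Lc (KInvStep (d := 3) Lc m)) Lc (Φ m y) ν y' + Ψ m y ν y') :=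
    fun m y ν y' => parityOdd_add (trK_vertexOfK_eq_neg_sgnK_of_rows _ (hPΦ m y) ν y') (hPΨ m y ν y')
  have hKs : ∀ m : ℕ, Spr (coDressKBmAt (toSite r) Lc (KInvStep (d := 3) Lc m)) := fun m => spr_of_decays (decays_coDressKBmAt_KInvStep (d := 3) hr' m)
  have hKt : ∀ m : ℕ, trK (coDressKBmAt (toSite r) Lc (KInvStep (d := 3) Lc m)) = sgnK (coDressKBmAt (toSite r) Lc (KInvStep (d := 3) Lc m)) := fun m => trK_coDressKBmAt_KInvStep (d := 3) hr' m
  -- D1's RAW TABLE LAWS at every level: level 0 from the Wilson letters (theorems) + `hBord0 ∕ ''`; level m+1 from the level-m kernel law + the PINNED lock + `hBordS ∕ ''`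
  have hT0 := tableLaw_T2RecAt_zero (r := r) cΛ cE₂ cB ((8 * (N : ℝ) ^ 2)⁻¹ • wsym22 N) (vh₂SAn1 Lc) (mixFFAt (toSite r) Lc)
    (hWil_wilson_TW_su hN Lc r hcE₂) hBord0
  have hT0'' := tableLaw_T2RecAt_zero'' (r := r) cΛ cE₂ cB ((8 * (N : ℝ) ^ 2)⁻¹ • wsym22 N) (vh₂SAn1 Lc) (mixFFAt (toSite r) Lc)
    (hWil''_wilson_TW_su hN Lc r hcE₂) hBord0''
  have hTS := fun m : ℕ => tableLaw_T2RecAt_succ hLc1 hr' cΛ cE₂ cB ((8 * (N : ℝ) ^ 2)⁻¹ • wsym22 N) ⟨CB, δB, hδB, hB⟩ hmix m (h𝒩 m) (hLAW m)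
    (lock_succ_of_pin hLc1 hcE₂ m) (hBordS m)
  have hTS'' := fun m : ℕ => tableLaw_T2RecAt_succ'' hLc1 hr' cΛ cE₂ cB ((8 * (N : ℝ) ^ 2)⁻¹ • wsym22 N) ⟨CB, δB, hδB, hB⟩ hmix m (h𝒩 m) (hLAW m)
    (lock_succ_of_pin hLc1 hcE₂ m) (hBordS'' m)
  subst hcE₂
  -- PART D at the pinned lock constants (INTENT 2's pin), the residual words := (table law's left side) − (commutator word): `hTL ∕ hTL''` are then identities,
  -- and their parities are read off D1's table laws level by level
  -- MY FILE 4 at the pinned lock constants, the residual words := (table law's left side) − (commutator word): `hTL ∕ hTL''` are identities, their parities read off D1's laws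
  refine exists_slavedDivRows_halfMember_three_of_wardLetters hL2 hr' ((Lc : ℝ) ^ (3 + 1)) (-((Lc : ℝ) ^ (3 + 1) * (1 / 2) * (Lc : ℝ) ^ (3 + 1))) cΛ ((Lc : ℝ) ^ (2 * (3 + 1))) cB rfl
    ((8 * (N : ℝ) ^ 2)⁻¹ • wsym22 N) (vh₂S := vh₂SAn1 Lc) (fun κ u κ' u' x z α β => vh₂SAn1_inl_inl κ u κ' u' x z α β) (fun κ u κ' u' x z μ ν => vh₂SAn1_inr_inr κ u κ' u' x z μ ν) hB hδB
    (cH := fun l => (stepScale 3 Lc l * (Lc : ℝ) ^ (3 + 1))⁻¹)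
    (R := fun l Y κ' u' =>
      (stepScale 3 Lc l * (Lc : ℝ) ^ (3 + 1))⁻¹ • ∑ v ∈ box (3 + 1) Lc, divV (fun κ u => T2RecAt 3 Lc (toSite r) ((Lc : ℝ) ^ (3 + 1)) (-((Lc : ℝ) ^ (3 + 1) * (1 / 2) * (Lc : ℝ) ^ (3 + 1))) cΛ ((Lc : ℝ) ^ (2 * (3 + 1))) cB ((8 * (N : ℝ) ^ 2)⁻¹ • wsym22 N) (vh₂SAn1 Lc) (mixFFAt (toSite r) Lc) l κ u κ' u') ((Lc : ℤ) • Y + toSite v)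
        - (comp (SpureRecAt 3 Lc (toSite r) ((Lc : ℝ) ^ (3 + 1)) (-((Lc : ℝ) ^ (3 + 1) * (1 / 2) * (Lc : ℝ) ^ (3 + 1))) cΛ l κ' u') (diagK (((1 : ℝ) / 2) • ∑ v ∈ box (3 + 1) Lc, legInd (toSite r) ((Lc : ℤ) • Y + toSite v))) - comp (diagK (((1 : ℝ) / 2) • ∑ v ∈ box (3 + 1) Lc, legInd (toSite r) ((Lc : ℤ) • Y + toSite v))) (SpureRecAt 3 Lc (toSite r) ((Lc : ℝ) ^ (3 + 1)) (-((Lc : ℝ) ^ (3 + 1) * (1 / 2) * (Lc : ℝ) ^ (3 + 1))) cΛ l κ' u')))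
    (R'' := fun l Y κ u =>
      (stepScale 3 Lc l * (Lc : ℝ) ^ (3 + 1))⁻¹ • ∑ v ∈ box (3 + 1) Lc, divV (T2RecAt 3 Lc (toSite r) ((Lc : ℝ) ^ (3 + 1)) (-((Lc : ℝ) ^ (3 + 1) * (1 / 2) * (Lc : ℝ) ^ (3 + 1))) cΛ ((Lc : ℝ) ^ (2 * (3 + 1))) cB ((8 * (N : ℝ) ^ 2)⁻¹ • wsym22 N) (vh₂SAn1 Lc) (mixFFAt (toSite r) Lc) l κ u) ((Lc : ℤ) • Y + toSite v)
        - (comp (SpureRecAt 3 Lc (toSite r) ((Lc : ℝ) ^ (3 + 1)) (-((Lc : ℝ) ^ (3 + 1) * (1 / 2) * (Lc : ℝ) ^ (3 + 1))) cΛ l κ u) (diagK (((1 : ℝ) / 2) • ∑ v ∈ box (3 + 1) Lc, legInd (toSite r) ((Lc : ℤ) • Y + toSite v))) - comp (diagK (((1 : ℝ) / 2) • ∑ v ∈ box (3 + 1) Lc, legInd (toSite r) ((Lc : ℤ) • Y + toSite v))) (SpureRecAt 3 Lc (toSite r) ((Lc : ℝ) ^ (3 + 1)) (-((Lc : ℝ)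 ^ (3 + 1) * (1 / 2) * (Lc : ℝ) ^ (3 + 1))) cΛ l κ u)))
    hcH0_pin_three hcH_pin_three (fun l Y κ' u' => (add_sub_cancel _ _).symm) (fun l Y κ u => (add_sub_cancel _ _).symm) ?_ ?_ hq_pin_three
  · intro l Y κ' u'
    cases l with
    | zero =>
      simp only [hT0 Y κ' u', add_sub_cancel_left]
      exact parityOdd_add (parityOdd_zero_family Y κ' u') (hRBp 0 Y κ' u')
    | succ m =>
      simp only [hTS m Y κ' u', add_sub_cancel_left]
      exact parityOdd_add (parityOdd_smul _ (parityOdd_sum _ fun v _ =>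
        parityOdd_mmRead Lc (parityOdd_sandwich (hKs m) (h𝒩 m _ κ' u') (hKt m) (h𝒩par m _ κ' u')))) (hRBp (m + 1) Y κ' u')
  · intro l Y κ u
    cases l with
    | zero =>
      simp only [hT0'' Y κ u, add_sub_cancel_left]
      exact parityOdd_add (parityOdd_zero_family Y κ u) (hRB''p 0 Y κ u)
    | succ m =>
      simp only [hTS'' m Y κ u, add_sub_cancel_left]
      exact parityOdd_add (parityOdd_smul _ (parityOdd_sum _ fun v _ =>
        parityOdd_mmRead Lc (parityOdd_sandwich (hKs m) (h𝒩 m _ κ u) (hKt m) (h𝒩par m _ κ u)))) (hRB''p (m + 1) Y κ u)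

/-! ## §2 At the literal of record: nothing displayed but the pins (p2's `…OfQLCSym` discharge text, target exchanged) -/

/-- NOT IN PRINT; OUR BOOKKEEPING.  **THE SLAVED SLOT-DIVERGENCE ROWS OF THE EVEN MEMBERS AND OF THEIR DRIFTS — THEOREMS AT THE LITERAL OF RECORD** (`Lc` odd, `2 ≤ Lc`,
`SU(N)` with `2 ≤ N`, `r = ctrOff 4 Lc`, the eight pins; `ε := 1`): MY FILE 3's `Hh₁ Hh₂ Hh₁d Hh₂d`, hypothesis-free — §1 with an1's border letters at lockB (d1's `bondWardB` ⨾
d1-leaf-05's unpacking, remainder ZERO, lifted by d1-leaf-06's `border_level_succ`) and the mixed letter (an3 ⨾ `mixedWardBinders`, lifted by `WardLocusParityLevels`). -/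
theorem exists_slavedDivRows_three_at_pin (hLc : Odd Lc) (hL2 : 2 ≤ Lc) {N : ℕ} (hN : 2 ≤ N) {r : Fin (3 + 1) → ℕ} (hr : r = ctrOff (3 + 1) Lc)
    {cE cVH cΛ cE₂ cB : ℝ} (hcE : cE = (Lc : ℝ) ^ (3 + 1)) (hcVH : cVH = -((Lc : ℝ) ^ (3 + 1) * (1 / 2) * (Lc : ℝ) ^ (3 + 1))) (hcΛ : cΛ = 2 / (Lc : ℝ) ^ 4) (hcE₂ : cE₂ = (Lc : ℝ) ^ (2 * (3 + 1)))
    (hcB : cB = -((Lc : ℝ) ^ 12 / 4)) {Tc : Fin 4 → Fin 4 → Fin 4 → Fin 4 → ℝ} (hTc : Tc = (8 * (N : ℝ) ^ 2)⁻¹ • wsym22 N)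
    {vh₂S : (Fin (3 + 1) → (Fin (3 + 1) → ℤ) → Fin (3 + 1) → (Fin (3 + 1) → ℤ) → MKer (3 + 1) (Fib 3))} (hvh : vh₂S = vh₂SAn1 Lc) :
    ∃ δ₃ σ₁ σ₂ σ₁d σ₂d ν₃ : ℝ, 0 < δ₃ ∧ 0 ≤ ν₃ ∧ ν₃ < 1 ∧
      (∀ n : ℕ, LocStencil₂ (fun (_ : Fin (3 + 1)) (p : Fin (3 + 1) → ℤ) (κ' : Fin (3 + 1)) (u' : Fin (3 + 1) → ℤ) =>
      divV (fun κ₁ u₁ => (((1 : ℝ) / 2) • (unitS₂ (sfStep Lc n) (smStep 3 Lc n) (T2RecAt 3 Lc (toSite r) cE cVH cΛ cE₂ cB Tc vh₂S (mixFFAt (toSite r) Lc) n) + (1 : ℝ) • fun κ u κ' u' => sgnK (trK ((unitS₂ (sfStep Lc n) (smStep 3 Lc n) (T2RecAt 3 Lc (toSite r) cE cVH cΛ cE₂ cB Tc vh₂S (mixFFAt (toSite r) Lc) n)) κ u κ' u')))) κ₁ u₁ κ' u') p) σ₁ δ₃) ∧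
      (∀ n : ℕ, LocStencil₂ (fun (κ : Fin (3 + 1)) (u : Fin (3 + 1) → ℤ) (_ : Fin (3 + 1)) (p : Fin (3 + 1) → ℤ) =>
      divV (fun κ₁ u₁ => (((1 : ℝ) / 2) • (unitS₂ (sfStep Lc n) (smStep 3 Lc n) (T2RecAt 3 Lc (toSite r) cE cVH cΛ cE₂ cB Tc vh₂S (mixFFAt (toSite r) Lc) n) + (1 : ℝ) • fun κ u κ' u' => sgnK (trK ((unitS₂ (sfStep Lc n) (smStep 3 Lc n) (T2RecAt 3 Lc (toSite r) cE cVH cΛ cE₂ cB Tc vh₂S (mixFFAt (toSite r) Lc) n)) κ u κ' u')))) κ u κ₁ u₁) p) σ₂ δ₃) ∧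
      (∀ n : ℕ, LocStencil₂ (fun (_ : Fin (3 + 1)) (p : Fin (3 + 1) → ℤ) (κ' : Fin (3 + 1)) (u' : Fin (3 + 1) → ℤ) =>
      divV (fun κ₁ u₁ => ((((1 : ℝ) / 2) • (unitS₂ (sfStep Lc (n + 1)) (smStep 3 Lc (n + 1)) (T2RecAt 3 Lc (toSite r) cE cVH cΛ cE₂ cB Tc vh₂S (mixFFAt (toSite r) Lc) (n + 1)) + (1 : ℝ) • fun κ u κ' u' => sgnK (trK ((unitS₂ (sfStep Lc (n + 1)) (smStep 3 Lc (n + 1)) (T2RecAt 3 Lc (toSite r) cE cVH cΛ cE₂ cB Tc vh₂S (mixFFAt (toSite r) Lc) (n + 1))) κ u κ' u'))))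
        - (((1 : ℝ) / 2) • (unitS₂ (sfStep Lc n) (smStep 3 Lc n) (T2RecAt 3 Lc (toSite r) cE cVH cΛ cE₂ cB Tc vh₂S (mixFFAt (toSite r) Lc) n) + (1 : ℝ) • fun κ u κ' u' => sgnK (trK ((unitS₂ (sfStep Lc n) (smStep 3 Lc n) (T2RecAt 3 Lc (toSite r) cE cVH cΛ cE₂ cB Tc vh₂S (mixFFAt (toSite r) Lc) n)) κ u κ' u'))))) κ₁ u₁ κ' u') p) (σ₁d * ν₃ ^ n) δ₃) ∧
      (∀ n : ℕ, LocStencil₂ (fun (κ : Fin (3 + 1)) (u : Fin (3 + 1) → ℤ) (_ : Fin (3 + 1)) (p : Fin (3 + 1) → ℤ) =>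
      divV (fun κ₁ u₁ => ((((1 : ℝ) / 2) • (unitS₂ (sfStep Lc (n + 1)) (smStep 3 Lc (n + 1)) (T2RecAt 3 Lc (toSite r) cE cVH cΛ cE₂ cB Tc vh₂S (mixFFAt (toSite r) Lc) (n + 1)) + (1 : ℝ) • fun κ u κ' u' => sgnK (trK ((unitS₂ (sfStep Lc (n + 1)) (smStep 3 Lc (n + 1)) (T2RecAt 3 Lc (toSite r) cE cVH cΛ cE₂ cB Tc vh₂S (mixFFAt (toSite r) Lc) (n + 1))) κ u κ' u'))))
        - (((1 : ℝ) / 2) • (unitS₂ (sfStep Lc n) (smStep 3 Lc n) (T2RecAt 3 Lc (toSite r) cE cVH cΛ cE₂ cB Tc vh₂S (mixFFAt (toSite r) Lc) n) + (1 : ℝ) • fun κ u κ' u' => sgnK (trK ((unitS₂ (sfStep Lc n) (smStep 3 Lc n) (T2RecAt 3 Lc (toSite r) cE cVH cΛ cE₂ cB Tc vh₂S (mixFFAt (toSite r) Lc) n)) κ u κ' u'))))) κ u κ₁ u₁) p) (σ₂d * ν₃ ^ n) δ₃) := by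
  have hLc1 : 1 ≤ Lc := by omega
  subst hr hcVH hcΛ hcB hvh
  -- an1's MIXED letter at the literal of record, level 0 — class, row parity, law with the residual `RWof Lc (2∕Lc⁴)` (an3's bond law ⨾ d1-leaf-05's packing): UNCONDITIONAL
  obtain ⟨⟨CM, δM, hδM, hclsM⟩, hRMp0, hM₂0⟩ := mixedWardBinders (Lc := Lc) hLc1
  have hCM : 0 ≤ CM := (hclsM 0 0 0).nonneg (Sum.inl 0)
  -- an1's BORDER letters at lockB `cB = −Lc¹²∕4`, level 0, both slots (d1's `bondWardB` ⨾ d1-leaf-05's unpacking): UNCONDITIONAL (`Lc` odd)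
  have hB0 := hBord0_of_bondWard (Lc := Lc) (-((Lc : ℝ) ^ 12 / 4)) (bondWardB hLc)
  have hB0'' := hBord0''_of_bondWard (Lc := Lc) (-((Lc : ℝ) ^ 12 / 4)) (bondWardB hLc)
  -- the zero border remainders' class
  have hz : ∀ (j : ℕ) (Y : Fin (3 + 1) → ℤ), LocStencil ((0 : ℕ → (Fin (3 + 1) → ℤ) → Fin (3 + 1) → (Fin (3 + 1) → ℤ) → MKer (3 + 1) (Fib 3)) j Y) (|wM1 3 Lc j| * CM) δM :=
    fun j Y κ u x z a b => by
      simp only [Pi.zero_apply, abs_zero]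
      positivity
  refine exists_slavedDivRows_three_of_borderLetters hLc hL2 hN rfl hcE rfl hcE₂ hTc rfl
    (RB := (0 : ℕ → (Fin (3 + 1) → ℤ) → Fin (3 + 1) → (Fin (3 + 1) → ℤ) → MKer (3 + 1) (Fib 3))) (RB'' := (0 : ℕ → (Fin (3 + 1) → ℤ) → Fin (3 + 1) → (Fin (3 + 1) → ℤ) → MKer (3 + 1) (Fib 3)))
    (RM := fun j y ρ' w => wM1 3 Lc j • RWof Lc (2 / (Lc : ℝ) ^ 4) y ρ' w)
    ⟨|wM1 3 Lc 0| * CM, δM, hδM, hz 0, hz 0, fun y => vertexFamily_smul (wM1 3 Lc 0) (hclsM y)⟩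
    (fun j => ⟨|wM1 3 Lc (j + 1)| * CM, δM, hδM, hz (j + 1), hz (j + 1), fun y => vertexFamily_smul (wM1 3 Lc (j + 1)) (hclsM y)⟩)
    (fun _ _ _ _ => parityOdd_zero) (fun _ _ _ _ => parityOdd_zero) (fun j y ρ' w => parityOdd_smul (d := 3) (wM1 3 Lc j) (hRMp0 y ρ' w))
    (fun Y κ' u' => ?_) (fun Y κ u => ?_) (fun j Y κ' u' => ?_) (fun j Y κ u => ?_) (fun j y ρ' w => ?_)
  · -- border, first slot, level 0
    simp only [Pi.zero_apply, add_zero]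
    exact hB0 Y κ' u'
  · -- border, second slot, level 0
    simp only [Pi.zero_apply, add_zero]
    exact hB0'' Y κ u
  · -- border, first slot, level j+1 = `wVH (j+1) •` level 0 (d1-leaf-06's scaling)
    simp only [Pi.zero_apply, add_zero]
    exact border_level_succ (-((Lc : ℝ) ^ 12 / 4)) (-((Lc : ℝ) ^ (3 + 1) * (1 / 2) * (Lc : ℝ) ^ (3 + 1)))
      (fun κ u => vh₂SAn1 Lc κ u κ' u') (vhSAt (toSite (ctrOff (3 + 1) Lc)) 3 Lc rfl κ' u') (diagK (((1 : ℝ) / 2) • ∑ v ∈ box (3 + 1) Lc, legInd (toSite (ctrOff (3 + 1) Lc)) ((Lc : ℤ) • Y + toSite v))) Y j (hB0 Y κ' u')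
  · -- border, second slot, level j+1
    simp only [Pi.zero_apply, add_zero]
    exact border_level_succ (-((Lc : ℝ) ^ 12 / 4)) (-((Lc : ℝ) ^ (3 + 1) * (1 / 2) * (Lc : ℝ) ^ (3 + 1)))
      (fun κ' u' => vh₂SAn1 Lc κ u κ' u') (vhSAt (toSite (ctrOff (3 + 1) Lc)) 3 Lc rfl κ u) (diagK (((1 : ℝ) / 2) • ∑ v ∈ box (3 + 1) Lc, legInd (toSite (ctrOff (3 + 1) Lc)) ((Lc : ℤ) • Y + toSite v))) Y j (hB0'' Y κ u)
  · -- mixed, level j = `wM1 j •` level 0, residual `wM1 j • RWof`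
    refine residual_law_smul (w := wM1 3 Lc j) ?_ ?_ (hM₂0 y ρ' w)
    · simp only [M2Of_apply]
      rw [smul_sum_divV_smul, smul_sum_divV_smul, smul_smul, cH_mul_wM2 hLc1 j]
    · rw [← comm_smul, ← M1At_eq_smul_zero_level]

end Summit.QuantumFields.BalabanUV.Beta.GAN24.SlavedDivRowsAtPin

end
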